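import Summits.CriticalPhenomena.PercolationContinuityZ3.Theorems.PercNearOneGluingNoHeavyLowerTailSunflowerChainCoverSafe
import Summits.CriticalPhenomena.PercolationContinuityZ3.Theorems.PercNearOneGluingNoHeavyLowerTailSunflowerGraphCoreTriangle
import HarnessLib

/-!
# `NoHeavyLowerTail` (crux stmt-CriticalPhenomena-4575), abstract sunflower cubic: CHAIN GRAPHS (DIFFERENCE GRAPHS) ARE A-SAFE,
# AND REMAIN SO NEXT TO ANY A-SAFE GRAPH — the graph form of `…SunflowerChainCover(Safe)`

Support file (seat `prim-ineq-prove-1` gen 44; `--supports stmt-CriticalPhenomena-4575`).  No `sorry`, no named facts.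
Memo: run/shared/lean/prim/prim-ineq-prove-1/FINDING-CHAINCOVER-prove1-g44.md §2.

A CHAIN GRAPH (difference graph, `2K₂`-free bipartite graph) in rank form: sides `L`, `R` (disjoint) with ranks `lam : L → ℕ`,
`rho : R → ℕ` and `l ~ r ⟺ rho r ≤ lam l` (`chainGraph L R lam rho`; every bipartite graph whose neighbourhoods on one side form a
chain is of this form — take `lam l = #N(l)` and `rho r = min {lam l : l ~ r}`; the half graph `H_m` is `lam = rho = id`).  Its
edge-core is the STAIRCASE CNF `⋀_k (Hit{l : lam l ≥ k} ∨ Hit{r : rho r < k})` (`edgeCore_chainGraph`), so `…SunflowerChainCover`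
applies:
* **`safe_edgeCore_chainGraph`** — the edge-core of every chain graph is SAFE at EVERY `p` (Lemma A for all numbers of petals,
  (C1-law), `H`/`G`/`T` rows, Kahn's Conjecture 5 on complements); `gsafe_edgeCore_chainGraph` — GRADEDLY safe when the core has
  positive probability (new for `|𝒯| ≥ 4`, e.g. the half graphs `H_m`, `m ≥ 3`; a certificate-free second proof of
  `Bridge.safe_edgeCore_of_bipartite` on the `2K₂`-free stratum);
* **`safe_edgeCore_chainGraph_sup`** — `Γ_chain ⊔ Γ₀` has a safe core for every graph `Γ₀` on the remaining vertices with a safe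
  core (both cores of positive probability): the first ⊔-closure result beyond complete bipartite components
  (`…SunflowerUnionEdge`, `…SunflowerUnionMatching`).
Also: `safe_of_real_eq_zero` (a core of probability zero is safe, by Harris) and `edgeCore_sup`.
-/

noncomputable section

namespace Summit.CriticalPhenomena.PercolationContinuityZ3.Theorems.SunflowerPartition

namespace SafeCalc

open MeasureTheory Finset
open Literature.Probability.LatticeModels Literature.Probability.Percolation

variable {ι : Type*} [DecidableEq ι] (p : ι → unitInterval)

/-! ## Two generalities -/

omit [DecidableEq ι] in
/-- **A core of probability zero is safe**: two petals meeting inside it have `μ(V₀) μ(V₁) ≤ μ(V₀ ∩ V₁) = 0` (Harris), so the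
product over the family vanishes. [this work] -/
theorem safe_of_real_eq_zero [Fintype ι] {A : Set (Set ι)} (hA : (prodBernoulli p).real A = 0) : Safe p A := by
  classical
  intro n V hV hcap
  rcases Nat.lt_or_ge n 2 with hn | hn
  · interval_cases n
    · simp
    · rw [Fin.prod_univ_one, Nat.sub_self, pow_zero]
      exact measureReal_le_one
  · set i₀ : Fin n := ⟨0, by omega⟩
    set i₁ : Fin n := ⟨1, by omega⟩
    have h01 : i₀ ≠ i₁ := fun h => by simp [i₀, i₁, Fin.ext_iff] at h
    have hH : (prodBernoulli p).real (V i₀) * (prodBernoulli p).real (V i₁) ≤ 0 :=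
      calc (prodBernoulli p).real (V i₀) * (prodBernoulli p).real (V i₁) ≤ (prodBernoulli p).real (V i₀ ∩ V i₁) :=
            prodBernoulli_harris p (hV i₀) (hV i₁) MeasurableSet.of_discrete MeasurableSet.of_discrete
        _ ≤ (prodBernoulli p).real A := measureReal_mono (hcap i₀ i₁ h01)
        _ = 0 := hA
    have h0 : (prodBernoulli p).real (V i₀) * (prodBernoulli p).real (V i₁) = 0 :=
      le_antisymm hH (mul_nonneg measureReal_nonneg measureReal_nonneg)
    have hR : (0 : ℝ) ≤ (prodBernoulli p).real A ^ (n - 1) := pow_nonneg measureReal_nonneg _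
    rcases mul_eq_zero.1 h0 with h | h
    · rw [Finset.prod_eq_zero (mem_univ i₀) h]; exact hR
    · rw [Finset.prod_eq_zero (mem_univ i₁) h]; exact hR

omit [DecidableEq ι] in
/-- The edge-core of a union of graphs is the union of the edge-cores. [this work] -/
theorem edgeCore_sup (Γ₁ Γ₂ : SimpleGraph ι) : edgeCore (Γ₁ ⊔ Γ₂) = edgeCore Γ₁ ∪ edgeCore Γ₂ := by
  ext ω
  simp only [edgeCore, SimpleGraph.sup_adj, Set.mem_setOf_eq, Set.mem_union]
  constructor
  · rintro ⟨u, v, h | h, hu, hv⟩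
    · exact Or.inl ⟨u, v, h, hu, hv⟩
    · exact Or.inr ⟨u, v, h, hu, hv⟩
  · rintro (⟨u, v, h, hu, hv⟩ | ⟨u, v, h, hu, hv⟩)
    · exact ⟨u, v, Or.inl h, hu, hv⟩
    · exact ⟨u, v, Or.inr h, hu, hv⟩

omit [DecidableEq ι] in
/-- If every edge of `Γ` lies inside `S`, the edge-core of `Γ` is determined by `S`. [this work] -/
theorem determinedBy_edgeCore_of_adj (Γ : SimpleGraph ι) {S : Set ι} (hS : ∀ u v, Γ.Adj u v → u ∈ S ∧ v ∈ S) :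
    DeterminedBy (edgeCore Γ) S := by
  rw [determinedBy_iff]
  have key : ∀ ω ω' : Set ι, ω ∩ S = ω' ∩ S → ω ∈ edgeCore Γ → ω' ∈ edgeCore Γ := by
    rintro ω ω' h ⟨u, v, huv, hu, hv⟩
    have eu := (Set.ext_iff.1 h u).1 ⟨hu, (hS u v huv).1⟩
    have ev := (Set.ext_iff.1 h v).1 ⟨hv, (hS u v huv).2⟩
    exact ⟨u, v, huv, eu.1, ev.1⟩
  exact fun ω ω' h => ⟨key ω ω' h, key ω' ω h.symm⟩

/-! ## Chain graphs in rank form -/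

section ChainGraph

variable (L R : Finset ι) (lam rho : ι → ℕ)

omit [DecidableEq ι] in
/-- **The chain graph** with sides `L`, `R` and ranks `lam`, `rho`: `l ~ r ⟺ rho r ≤ lam l`. [this work] -/
def chainGraph : SimpleGraph ι where
  Adj u v := u ≠ v ∧ ((u ∈ L ∧ v ∈ R ∧ rho v ≤ lam u) ∨ (v ∈ L ∧ u ∈ R ∧ rho u ≤ lam v))
  symm := ⟨fun _ _ h => ⟨h.1.symm, h.2.symm⟩⟩
  loopless := ⟨fun _ h => h.1 rfl⟩

variable (M : ℕ)

/-- The antitone side of the staircase of a chain graph: `P k = {l ∈ L : k ≤ lam l}`. [this work] -/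
def chainP (k : Fin (M + 2)) : Finset ι := L.filter fun l => (k : ℕ) ≤ lam l

/-- The monotone side of the staircase of a chain graph: `Q k = {r ∈ R : rho r < k}`. [this work] -/
def chainQ (k : Fin (M + 2)) : Finset ι := R.filter fun r => rho r < (k : ℕ)

/-- The staircase of a chain graph satisfies the staircase hypotheses. [this work] -/
theorem isStair_chain (hLR : Disjoint L R) : IsStair (chainP L lam M) (chainQ R rho M) where
  anti := fun j k hjk l hl => by
    rw [chainP, mem_filter] at hl ⊢
    exact ⟨hl.1, le_trans (Fin.le_iff_val_le_val.1 hjk) hl.2⟩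
  mono := fun j k hjk r hr => by
    rw [chainQ, mem_filter] at hr ⊢
    exact ⟨hr.1, lt_of_lt_of_le hr.2 (Fin.le_iff_val_le_val.1 hjk)⟩
  disj := by
    refine hLR.mono ?_ ?_
    · exact biUnion_subset.2 fun _ _ => filter_subset _ _
    · exact biUnion_subset.2 fun _ _ => filter_subset _ _

/-- **The edge-core of a chain graph is its staircase CNF**: `ω` contains an edge iff it meets every
`{l : lam l ≥ k} ∪ {r : rho r < k}` (`k ≤ M + 1`, `M` a bound for `lam` on `L`). [this work] -/
theorem edgeCore_chainGraph (hLR : Disjoint L R) (hM : ∀ l ∈ L, lam l ≤ M) :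
    edgeCore (chainGraph L R lam rho) = clauseCore (stair (chainP L lam M) (chainQ R rho M)) := by
  classical
  ext ω
  constructor
  · rintro ⟨u, v, ⟨_, h⟩, hu, hv⟩ C hC
    obtain ⟨k, _, rfl⟩ := mem_image.1 hC
    -- normalise to `l ∈ L`, `r ∈ R`, `rho r ≤ lam l`, both in `ω`
    obtain ⟨l, r, hl, hr, hlr, hlω, hrω⟩ : ∃ l r, l ∈ L ∧ r ∈ R ∧ rho r ≤ lam l ∧ l ∈ ω ∧ r ∈ ω := by
      rcases h with ⟨h1, h2, h3⟩ | ⟨h1, h2, h3⟩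
      · exact ⟨u, v, h1, h2, h3, hu, hv⟩
      · exact ⟨v, u, h1, h2, h3, hv, hu⟩
    by_cases hk : (k : ℕ) ≤ lam l
    · exact ⟨l, mem_union.2 (Or.inl (mem_filter.2 ⟨hl, hk⟩)), hlω⟩
    · exact ⟨r, mem_union.2 (Or.inr (mem_filter.2 ⟨hr, by omega⟩)), hrω⟩
  · intro h
    -- the clauses of the staircase
    have hit : ∀ k : Fin (M + 2), ∃ e ∈ chainP L lam M k ∪ chainQ R rho M k, e ∈ ω :=
      fun k => h _ (mem_image_of_mem _ (mem_univ k))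
    -- the occupied part of `L`
    set A : Finset ι := L.filter fun l => l ∈ ω with hA
    by_cases hAe : A = ∅
    · -- clause `0` is `L`: contradiction
      obtain ⟨e, he, heω⟩ := hit ⟨0, by omega⟩
      rcases mem_union.1 he with he | he
      · have : e ∈ A := mem_filter.2 ⟨(mem_filter.1 he).1, heω⟩
        rw [hAe] at this
        exact absurd this (notMem_empty e)
      · exact absurd (mem_filter.1 he).2 (Nat.not_lt_zero _)
    · obtain ⟨l, hlA, hmax⟩ := exists_max_image A lam (nonempty_iff_ne_empty.2 hAe)
      have hl : l ∈ L := (mem_filter.1 hlA).1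
      have hlω : l ∈ ω := (mem_filter.1 hlA).2
      obtain ⟨e, he, heω⟩ := hit ⟨lam l + 1, by have := hM l hl; omega⟩
      rcases mem_union.1 he with he | he
      · -- an occupied `l'` of larger rank: impossible
        have h1 := mem_filter.1 he
        have h2 := hmax e (mem_filter.2 ⟨h1.1, heω⟩)
        simp only at h1
        omega
      · have h1 := mem_filter.1 he
        have hne : l ≠ e := fun hle => Finset.disjoint_left.1 hLR hl (hle ▸ h1.1)
        refine ⟨l, e, ⟨hne, Or.inl ⟨hl, h1.1, ?_⟩⟩, hlω, heω⟩
        simp only at h1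
        omega

/-- **CHAIN GRAPHS ARE A-SAFE**: the edge-core of a chain graph is safe at every `p`. [this work] -/
theorem safe_edgeCore_chainGraph [Fintype ι] (hLR : Disjoint L R) (p : ι → unitInterval) :
    Safe p (edgeCore (chainGraph L R lam rho)) := by
  classical
  have hM : ∀ l ∈ L, lam l ≤ L.sup lam := fun l hl => le_sup hl
  rw [edgeCore_chainGraph L R lam rho (L.sup lam) hLR hM]
  rcases (measureReal_nonneg (μ := prodBernoulli p)
      (s := clauseCore (stair (chainP L lam (L.sup lam)) (chainQ R rho (L.sup lam))))).eq_or_lt with h0 | hpos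
  · exact safe_of_real_eq_zero p h0.symm
  · exact safe_stair p (isStair_chain L R lam rho _ hLR) hpos

/-- The block of the staircase of a chain graph (the non-isolated vertices it uses). [this work] -/
def chainBlock : Finset ι := blockP (chainP L lam M) ∪ blockQ (chainQ R rho M)

/-- The block lies inside `L ∪ R`. [this work] -/
theorem chainBlock_subset : chainBlock L R lam rho M ⊆ L ∪ R :=
  union_subset_union (biUnion_subset.2 fun _ _ => filter_subset _ _) (biUnion_subset.2 fun _ _ => filter_subset _ _)

/-- **CHAIN GRAPHS ARE GRADEDLY SAFE** on the block of their staircase, whenever the core has positive probability. [this work] -/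
theorem gsafe_edgeCore_chainGraph [Fintype ι] (hLR : Disjoint L R) (hM : ∀ l ∈ L, lam l ≤ M)
    (hpos : 0 < (prodBernoulli p).real (edgeCore (chainGraph L R lam rho))) :
    GSafe p (chainBlock L R lam rho M) (edgeCore (chainGraph L R lam rho)) := by
  rw [edgeCore_chainGraph L R lam rho M hLR hM] at hpos ⊢
  exact gsafe_stair p (isStair_chain L R lam rho M hLR) hpos

/-- **A CHAIN GRAPH NEXT TO A SAFE GRAPH**: if every edge of `Γ₀` avoids `L ∪ R`, and both cores have positive probability, then
`Safe p (edgeCore Γ₀)` implies `Safe p (edgeCore (chainGraph L R lam rho ⊔ Γ₀))`. [this work] -/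
theorem safe_edgeCore_chainGraph_sup [Fintype ι] (hLR : Disjoint L R) (Γ₀ : SimpleGraph ι)
    (hΓ₀ : ∀ u v, Γ₀.Adj u v → u ∉ L ∪ R ∧ v ∉ L ∪ R)
    (hpos : 0 < (prodBernoulli p).real (edgeCore (chainGraph L R lam rho)))
    (hpos₀ : 0 < (prodBernoulli p).real (edgeCore Γ₀)) (h₀ : Safe p (edgeCore Γ₀)) :
    Safe p (edgeCore (chainGraph L R lam rho ⊔ Γ₀)) := by
  classical
  have hM : ∀ l ∈ L, lam l ≤ L.sup lam := fun l hl => le_sup hl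
  rw [edgeCore_sup, edgeCore_chainGraph L R lam rho (L.sup lam) hLR hM]
  rw [edgeCore_chainGraph L R lam rho (L.sup lam) hLR hM] at hpos
  refine safe_stair_union p (isStair_chain L R lam rho _ hLR) hpos ?_ (isUpperSet_edgeCore Γ₀) hpos₀ h₀
  refine determinedBy_edgeCore_of_adj Γ₀ fun u v huv => ?_
  have hb := chainBlock_subset L R lam rho (L.sup lam)
  refine ⟨fun hu => (hΓ₀ u v huv).1 (hb ?_), fun hv => (hΓ₀ u v huv).2 (hb ?_)⟩
  · exact Finset.mem_coe.1 hu
  · exact Finset.mem_coe.1 hv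

end ChainGraph

end SafeCalc

end Summit.CriticalPhenomena.PercolationContinuityZ3.Theorems.SunflowerPartition
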